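import Mathlib
import HarnessLib
import Summits.NavierStokesRegularity.NavierStokesRegularity.Theorems.LocalVelCompTubeDoorLocalPointZoomVelSlices
import Summits.NavierStokesRegularity.NavierStokesRegularity.Theorems.LocalSineTubeDoorLocalPointZoomGrad
import Summits.NavierStokesRegularity.NavierStokesRegularity.Theorems.LocalSineTubeDoorLocalPointZoomGradSlices
import Summits.NavierStokesRegularity.NavierStokesRegularity.Theorems.LocalSineTubeDoorLocalPointZoomUniform
import Literature.Analysis.FluidPDE.LocalAffineChainRules

/-!
# The door family's universal SECOND-ORDER zoom crux: local point zoom with pointwise convergence of the VELOCITIES,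
# the VELOCITY GRADIENTS and the VELOCITY HESSIANS on every slice, along ONE common subsequence

Cell ns-regularity-ideate, seat p6 (route-directed support for nsreg-p1's one-window door family; anchor
`--supports stmt-NavierStokesRegularity-20017`, the zoom item of route LocalSineTubeDoor whose frame is re-used).  Extends
`…LocalPointZoomGradSlices.localPointZoomVelGradSlices` by the second spatial derivatives, so that window doors reading
SECOND-ORDER scalars (built from `u, ∇u, ∇²u`: e.g. the super-helicity `ω · curl ω`, `∇ω`-alignment, `Δu`-based quantities)
have their zoom crux by name:

* `compContinuousLinearMap_smul_id_two`, `iteratedFDeriv_two_smul_stPull` — chain rule for `D²` under the amplitude-scaled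
  parabolic pull-back, `D²((c u)∘Φ)(s,·)(y) = (c γ²) • D²(u t)(x)` for a `C²` slice (tree
  `iteratedFDeriv_two_comp_affine_of_contDiffOn`);
* `localPointZoomVelGradHessSlices` — local Type I + not backward bounded ⇒ ONE zoom sequence `λⱼ → 0⁺` and a Type-I
  Oseen-mild div-free profile `v` singular at the apex with, at EVERY `s < 0`, `y`:
  `(λⱼ/ν) u(tⱼ, xⱼ) → v(s,y)`, `(λⱼ²/ν) Du(tⱼ)(xⱼ) → Dv(s)(y)`, `(λⱼ³/ν) D²u(tⱼ)(xⱼ) → D²v(s)(y)` where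
  `tⱼ = T + λⱼ²s/ν`, `xⱼ = x₀ + λⱼy` (interior upgrades `localZoomFrame_tendsto`, `localZoomFrame_fderiv_tendsto` and (H) of
  `localZoomFrame_uniform` at time `−1` of the `√(−s)`-rescaled frame; the Hessian identification holds eventually, once
  `tⱼ ∈ [0,T)` where `u(tⱼ)` is smooth).

WHAT THIS IS NOT: not a claim about Navier–Stokes regularity; a blow-up/compactness lemma for door routes
(bears_on LADDER-NS N0).
-/

noncomputable section

-- the summit and its single sub-problem share the name (CONVENTIONS §1), as in every Theorems file
set_option linter.dupNamespace false

namespace Summit.NavierStokesRegularity.NavierStokesRegularity.Theorems.LocalSineTubeDoorLocalPointZoomHessSlices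

open MeasureTheory Set Function Filter Topology TopologicalSpace Metric
open Literature.Analysis Literature.Analysis.FluidPDE Literature.Analysis.FluidPDE.SereginSverak2009
open Summit.NavierStokesRegularity.NavierStokesRegularity.Theorems
open Summit.NavierStokesRegularity.NavierStokesRegularity.Theorems.LocalSineTubeDoorLocalPointZoomFrame
open Summit.NavierStokesRegularity.NavierStokesRegularity.Theorems.LocalSineTubeDoorLocalPointZoomCurl
open Summit.NavierStokesRegularity.NavierStokesRegularity.Theorems.LocalSineTubeDoorLocalPointZoomSlices
open Summit.NavierStokesRegularity.NavierStokesRegularity.Theorems.LocalVelCompTubeDoorLocalPointZoomVel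
open Summit.NavierStokesRegularity.NavierStokesRegularity.Theorems.LocalSineTubeDoorLocalPointZoomGrad
open Summit.NavierStokesRegularity.NavierStokesRegularity.Theorems.LocalSineTubeDoorLocalPointZoomGradSlices
open Summit.NavierStokesRegularity.NavierStokesRegularity.Theorems.LocalSineTubeDoorLocalPointZoomUniform
open Summit.NavierStokesRegularity.NavierStokesRegularity.Theorems.LocalSineTubeDoorProfileAlignedWindowRigidityAncient
open scoped NNReal ENNReal

/-- Pre-composing a bilinear (2-multilinear) map with the homothety `γ • id` in both slots multiplies it by `γ²`. -/
theorem compContinuousLinearMap_smul_id_two {F : Type*} [NormedAddCommGroup F] [NormedSpace ℝ F]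
    (A : ContinuousMultilinearMap ℝ (fun _ : Fin 2 => EuclideanSpace ℝ (Fin 3)) F) (γ : ℝ) :
    (A.compContinuousLinearMap fun _ => γ • ContinuousLinearMap.id ℝ (EuclideanSpace ℝ (Fin 3))) = γ ^ 2 • A := by
  ext m
  rw [ContinuousMultilinearMap.compContinuousLinearMap_apply, smul_apply]
  have h : (fun i : Fin 2 => (γ • ContinuousLinearMap.id ℝ (EuclideanSpace ℝ (Fin 3))) (m i)) =
      fun i : Fin 2 => (fun _ : Fin 2 => γ) i • m i := by
    funext i
    simp
  rw [h, A.map_smul_univ, Fin.prod_const]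

/-- Chain rule for `D²` under the amplitude-`c` parabolic pull-back `Φ(s, y) = (t₀ + β s, x₀ + γ y)`, for a `C²` slice:
`D²((c u) ∘ Φ)(s, ·)(y) = (c γ²) • D²(u t)(x)` at `(t, x) = Φ(s, y)`. -/
theorem iteratedFDeriv_two_smul_stPull {c β γ t₀ : ℝ} {x₀ : EuclideanSpace ℝ (Fin 3)}
    {u : ℝ → EuclideanSpace ℝ (Fin 3) → EuclideanSpace ℝ (Fin 3)} {s : ℝ}
    (hu : ContDiff ℝ 2 (u (t₀ + β * s))) (y : EuclideanSpace ℝ (Fin 3)) :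
    iteratedFDeriv ℝ 2 ((c • stPull β γ t₀ x₀ u) s) y =
      (c * γ ^ 2) • iteratedFDeriv ℝ 2 (u (t₀ + β * s)) (x₀ + γ • y) := by
  have h1 : (c • stPull β γ t₀ x₀ u) s = fun z => c • (fun z' => u (t₀ + β * s) (x₀ + γ • z')) z := by
    funext z
    simp only [smul_stPull_apply]
  have hcomp : ContDiff ℝ 2 (fun z' : EuclideanSpace ℝ (Fin 3) => u (t₀ + β * s) (x₀ + γ • z')) :=
    hu.comp (contDiff_const.add (contDiff_id.const_smul γ))
  rw [h1, iteratedFDeriv_const_smul_apply' hcomp.contDiffAt,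
    iteratedFDeriv_two_comp_affine_of_contDiffOn hu.contDiffOn isOpen_univ x₀ γ (mem_univ _),
    compContinuousLinearMap_smul_id_two, smul_smul]

/-- **LOCAL POINT ZOOM LIMIT WITH VELOCITY, GRADIENT AND HESSIAN SLICES** (the universal second-order zoom crux of
the door family): at a point where a classical Leray–Hopf flow from rapidly decaying data is LOCALLY Type I but not backward
bounded, some zoom sequence `λⱼ → 0⁺` of unit-viscosity rescalings converges to a Type-I-rate, continuous, Oseen-mild,
divergence-free profile `v` with backward-singular apex, and at EVERY `s < 0`, `y`, BOTH the rescaled velocities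
`(λⱼ/ν) u(T + λⱼ²s/ν, x₀ + λⱼy) → v(s,y)` AND the rescaled velocity gradients
`(λⱼ²/ν) Du(T + λⱼ²s/ν)(x₀ + λⱼy) → Dv(s)(y)` AND the rescaled Hessians `(λⱼ³/ν) D²u(T + λⱼ²s/ν)(x₀ + λⱼy) → D²v(s)(y)`
— along ONE common sequence `λⱼ`. -/
theorem localPointZoomVelGradHessSlices :
    ∀ (ν T : ℝ), 0 < ν → 0 < T → ∀ (u : ℝ → EuclideanSpace ℝ (Fin 3) → EuclideanSpace ℝ (Fin 3))
      (p : ℝ → EuclideanSpace ℝ (Fin 3) → ℝ),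
    Literature.Analysis.FluidPDE.IsClassicalNSSolutionOn (Set.Ico 0 T) ν 0 u p →
    Literature.Analysis.FluidPDE.IsLerayHopfOn T ν 0 (u 0) u →
    Literature.Analysis.FluidPDE.HasRapidSpatialDecay (u 0) →
    ∀ (x₀ : EuclideanSpace ℝ (Fin 3)) (ρ M : ℝ), 0 < ρ →
    (∀ t ∈ Set.Ico 0 T, T - ρ ^ 2 < t → ∀ x ∈ Metric.ball x₀ ρ, ‖u t x‖ * Real.sqrt (ν * (T - t)) ≤ M) →
    ¬ Literature.Analysis.FluidPDE.IsBackwardBoundedAt u T x₀ →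
    ∃ (C : ℝ) (v : ℝ → EuclideanSpace ℝ (Fin 3) → EuclideanSpace ℝ (Fin 3)) (lam : ℕ → ℝ),
      (∀ j, 0 < lam j) ∧ Filter.Tendsto lam Filter.atTop (nhds 0) ∧
      (Literature.Analysis.FluidPDE.HasTypeITimeDecay C v ∧
        ContinuousOn (Function.uncurry v) (Set.Iio (0 : ℝ) ×ˢ Set.univ) ∧
        (∀ s t : ℝ, s < t → t < 0 → ∀ x, v t x =
          Literature.Analysis.UnboundedOperators.heatExtension (v s) (t - s) x -
            Literature.Analysis.FluidPDE.oseenDuhamel 1 s v v t x) ∧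
        (∀ t < 0, Literature.Analysis.FluidPDE.VectorCalculus.IsDivFree (v t))) ∧
      Literature.Analysis.FluidPDE.IsBackwardSingularPoint v 0 ∧
      ∀ s < 0, ∀ y,
        Filter.Tendsto (fun j => (lam j / ν) • u (T + lam j ^ 2 * s / ν) (x₀ + lam j • y)) Filter.atTop
          (nhds (v s y)) ∧
        Filter.Tendsto (fun j => (lam j ^ 2 / ν) •
          fderiv ℝ (u (T + lam j ^ 2 * s / ν)) (x₀ + lam j • y)) Filter.atTop
          (nhds (fderiv ℝ (v s) y)) ∧
        Filter.Tendsto (fun j => (lam j ^ 3 / ν) •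
          iteratedFDeriv ℝ 2 (u (T + lam j ^ 2 * s / ν)) (x₀ + lam j • y)) Filter.atTop
          (nhds (iteratedFDeriv ℝ 2 (v s) y)) := by
  intro ν T hν hT u p hsol hLH _ x₀ ρ M hρ hM hnotbd
  obtain ⟨R, C₁, v', π', lam, w, v₁, Ks, r₁, hR, hlam, hlam0, hball1, hr₁, hr₁1, hKs, hL3, hae, hP,
    hsing₁, hpt⟩ := localTreeZoomFrame hν hT hsol hLH hρ hM hnotbd
  refine ⟨C₁, v₁, fun j => R * (lam j / 2), fun j => mul_pos hR (half_pos (hlam j)),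
    by simpa using (hlam0.div_const 2).const_mul R, hP, hsing₁, fun s hs y => ?_⟩
  -- ## the scaling factor `σ = √(−s)`
  have hns : 0 < -s := neg_pos.2 hs
  set σ : ℝ := Real.sqrt (-s) with hσdef
  have hσ : 0 < σ := Real.sqrt_pos.2 hns
  have hσ2 : σ ^ 2 = -s := Real.sq_sqrt hns.le
  have hσne : σ ≠ 0 := hσ.ne'
  -- ## the rescaled frame
  set lam' : ℕ → ℝ := fun j => σ * lam j with hlam'def
  have hlam' : ∀ j, 0 < lam' j := fun j => mul_pos hσ (hlam j)
  have hlam0' : Tendsto lam' atTop (𝓝 0) := by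
    show Tendsto (fun j => σ * lam j) atTop (𝓝 0)
    simpa using hlam0.const_mul σ
  set w' : ℝ → (EuclideanSpace ℝ (Fin 3)) → (EuclideanSpace ℝ (Fin 3)) :=
    σ • stPull (σ ^ 2) σ (0 : ℝ) (0 : (EuclideanSpace ℝ (Fin 3))) w with hw'def
  set v₁' : ℝ → (EuclideanSpace ℝ (Fin 3)) → (EuclideanSpace ℝ (Fin 3)) :=
    σ • stPull (σ ^ 2) σ (0 : ℝ) (0 : (EuclideanSpace ℝ (Fin 3))) v₁ with hv₁'def
  have hZZ : ∀ j, (lam' j) • stPull ((lam' j) ^ 2) (lam' j) (0 : ℝ) (0 : (EuclideanSpace ℝ (Fin 3))) v' =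
      σ • stPull (σ ^ 2) σ (0 : ℝ) (0 : (EuclideanSpace ℝ (Fin 3)))
        ((lam j) • stPull ((lam j) ^ 2) (lam j) (0 : ℝ) (0 : (EuclideanSpace ℝ (Fin 3))) v') := by
    intro j
    simp only [hlam'def]
    rw [zoom_zoom]
  -- (pt') identification with the zooms of `u` at the scales `R σλⱼ/2`
  have hpt' : ∀ (j : ℕ) (s' : ℝ) (y' : (EuclideanSpace ℝ (Fin 3))),
      ((lam' j) • stPull ((lam' j) ^ 2) (lam' j) (0 : ℝ) (0 : (EuclideanSpace ℝ (Fin 3))) v') s' y' =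
        ((R * (lam' j / 2)) / ν) • u (T + (R * (lam' j / 2)) ^ 2 * s' / ν) (x₀ + (R * (lam' j / 2)) • y') := by
    intro j s' y'
    have h := hpt j (σ ^ 2 * s') (σ • y')
    simp only [smul_stPull_apply, zero_add] at h ⊢
    simp only [hlam'def]
    rw [show (σ * lam j) ^ 2 * s' = lam j ^ 2 * (σ ^ 2 * s') by ring,
      show (σ * lam j) • y' = lam j • σ • y' by rw [smul_smul, mul_comm],
      mul_smul, h, smul_smul, smul_smul,
      show σ * (R * (lam j / 2) / ν) = R * (σ * lam j / 2) / ν by ring,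
      show T + (R * (lam j / 2)) ^ 2 * (σ ^ 2 * s') / ν = T + (R * (σ * lam j / 2)) ^ 2 * s' / ν by ring,
      show R * (lam j / 2) * σ = R * (σ * lam j / 2) by ring]
  -- (L3') local `L³` convergence of the rescaled zooms to `w'`
  have hus : ∀ f g : ℝ → (EuclideanSpace ℝ (Fin 3)) → (EuclideanSpace ℝ (Fin 3)),
      uncurry (f - g) = uncurry f - uncurry g := fun f g => rfl
  have hL3' : ∀ a : ℝ, 0 < a → Tendsto (fun j => eLpNorm
      (uncurry ((lam' j) • stPull ((lam' j) ^ 2) (lam' j) (0 : ℝ) (0 : (EuclideanSpace ℝ (Fin 3))) v') - uncurry w') 3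
      (volume.restrict (parabolicCylinder a (0 : ℝ × (EuclideanSpace ℝ (Fin 3)))))) atTop (𝓝 0) := by
    intro a ha
    have hdiff : ∀ j, uncurry ((lam' j) • stPull ((lam' j) ^ 2) (lam' j) (0 : ℝ) (0 : (EuclideanSpace ℝ (Fin 3))) v') -
        uncurry w' = uncurry (σ • stPull (σ ^ 2) σ (0 : ℝ) (0 : (EuclideanSpace ℝ (Fin 3)))
          ((lam j) • stPull ((lam j) ^ 2) (lam j) (0 : ℝ) (0 : (EuclideanSpace ℝ (Fin 3))) v' - w)) := by
      intro j
      rw [hZZ j]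
      funext z
      obtain ⟨s', y'⟩ := z
      simp only [hw'def, uncurry_apply_pair, Pi.sub_apply, smul_stPull_apply, smul_sub]
    have hconst : (‖σ‖ₑ * (ENNReal.ofReal ((σ ^ 2 * σ ^ 3)⁻¹)) ^ (1 / (3 : ℝ≥0∞).toReal)) ≠ ⊤ :=
      ENNReal.mul_ne_top enorm_ne_top
        (ENNReal.rpow_ne_top_of_nonneg (one_div_nonneg.2 ENNReal.toReal_nonneg) ENNReal.ofReal_ne_top)
    have key := ENNReal.Tendsto.const_mul (hL3 (a * σ) (mul_pos ha hσ)) (Or.inr hconst)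
    rw [mul_zero] at key
    refine key.congr fun j => ?_
    rw [hdiff j]
    conv_rhs => rw [show a = a * σ / σ by field_simp]
    rw [eLpNorm_uncurry_zoom hσ σ _ (a * σ) three_ne_zero ENNReal.ofNat_ne_top, hus]
  -- (ae') the rescaled limit agrees a.e. with the rescaled profile
  have hslab : stAffine (σ ^ 2) σ (0 : ℝ) (0 : (EuclideanSpace ℝ (Fin 3))) ⁻¹'
      (Iio (0 : ℝ) ×ˢ (univ : Set (EuclideanSpace ℝ (Fin 3)))) =
      Iio (0 : ℝ) ×ˢ (univ : Set (EuclideanSpace ℝ (Fin 3))) := by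
    ext z
    simp only [mem_preimage, mem_prod, mem_Iio, mem_univ, and_true, stAffine_fst, zero_add]
    exact ⟨fun h => neg_of_mul_neg_right h (pow_pos hσ 2).le,
      fun h => mul_neg_of_pos_of_neg (pow_pos hσ 2) h⟩
  have hae' : ∀ᵐ x ∂(volume.restrict (Iio (0 : ℝ) ×ˢ (univ : Set (EuclideanSpace ℝ (Fin 3))))),
      uncurry w' x = uncurry v₁' x := by
    have h := ae_eq_restrict_comp_stAffine (f := uncurry w) (g := uncurry v₁) (pow_pos hσ 2) hσ
      (0 : ℝ) (0 : (EuclideanSpace ℝ (Fin 3))) hae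
    rw [hslab] at h
    filter_upwards [h] with z hz
    show σ • uncurry w (stAffine (σ ^ 2) σ (0 : ℝ) (0 : (EuclideanSpace ℝ (Fin 3))) z) =
      σ • uncurry v₁ (stAffine (σ ^ 2) σ (0 : ℝ) (0 : (EuclideanSpace ℝ (Fin 3))) z)
    rw [show uncurry w (stAffine (σ ^ 2) σ (0 : ℝ) (0 : (EuclideanSpace ℝ (Fin 3))) z) =
      uncurry v₁ (stAffine (σ ^ 2) σ (0 : ℝ) (0 : (EuclideanSpace ℝ (Fin 3))) z) from hz]
  -- (P') the rescaled profile is in the class (scaling invariance of rate / continuity / mildness)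
  have hrate' : HasTypeITimeDecay C₁ v₁' := rate_smul_stPull hP.1 hσ
  have hcont' : ContinuousOn (uncurry v₁') (Iio (0 : ℝ) ×ˢ univ) := cont_smul_stPull hP.2.1 hσ
  have hmild' := mild_smul_stPull hP.2.2.1 hσ
  -- ## common bookkeeping: the time and the scale at slice `s`
  have e2 : ∀ j, T + (R * (σ * lam j / 2)) ^ 2 * (-1) / ν = T + (R * (lam j / 2)) ^ 2 * s / ν := by
    intro j
    have hs' : s = -σ ^ 2 := by rw [hσ2]; ring
    rw [hs']; ring
  have e3 : ∀ j, R * (σ * lam j / 2) * σ⁻¹ = R * (lam j / 2) := by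
    intro j
    calc R * (σ * lam j / 2) * σ⁻¹ = R * (lam j / 2) * (σ * σ⁻¹) := by ring
      _ = R * (lam j / 2) := by rw [mul_inv_cancel₀ hσne, mul_one]
  refine ⟨?_, ?_, ?_⟩
  · -- ## (i) VELOCITIES: the velocity upgrade at time `−1` of the rescaled frame
    have key := localZoomFrame_tendsto hν hT hsol.smooth_velocity.continuousOn hρ hM hR hball1 hlam'
      hlam0' hr₁ hr₁1 hKs hpt' hL3' hae' hcont' (σ⁻¹ • y)
    have hZ : ∀ j, ((lam' j) • stPull ((lam' j) ^ 2) (lam' j) (0 : ℝ) (0 : (EuclideanSpace ℝ (Fin 3))) v') (-1)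
        (σ⁻¹ • y) = σ • (((R * (lam j / 2)) / ν) • u (T + (R * (lam j / 2)) ^ 2 * s / ν)
          (x₀ + (R * (lam j / 2)) • y)) := by
      intro j
      rw [hpt' j (-1) (σ⁻¹ • y)]
      simp only [hlam'def, smul_smul]
      have e4 : R * (σ * lam j / 2) / ν = σ * (R * (lam j / 2) / ν) := by ring
      rw [e2 j, e3 j, e4]
    have hlimit : v₁' (-1) (σ⁻¹ • y) = σ • v₁ s y := by
      simp only [hv₁'def, smul_stPull_apply, smul_smul, mul_inv_cancel₀ hσne, one_smul, zero_add]
      rw [show σ ^ 2 * (-1) = s by rw [hσ2]; ring]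
    have key' : Tendsto (fun j => σ • (((R * (lam j / 2)) / ν) •
        u (T + (R * (lam j / 2)) ^ 2 * s / ν) (x₀ + (R * (lam j / 2)) • y))) atTop (𝓝 (σ • v₁ s y)) := by
      rw [← hlimit]
      exact Tendsto.congr hZ key
    have key3 := key'.const_smul σ⁻¹
    simp only [smul_smul, inv_mul_cancel_left₀ hσne, inv_mul_cancel₀ hσne, one_smul] at key3
    exact key3
  · -- ## (ii) GRADIENTS: the gradient upgrade at time `−1` of the rescaled frame
    have key := localZoomFrame_fderiv_tendsto hν hT hsol.smooth_velocity.continuousOn hρ hM hR hball1 hlam'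
      hlam0' hr₁ hr₁1 hKs hpt' hL3' hae' hrate' hcont' hmild' (σ⁻¹ • y)
    have hgradZ : ∀ j, fderiv ℝ (((lam' j) • stPull ((lam' j) ^ 2) (lam' j) (0 : ℝ) (0 : (EuclideanSpace ℝ (Fin 3))) v') (-1))
        (σ⁻¹ • y) = (-s) • (((R * (lam j / 2)) ^ 2 / ν) •
          fderiv ℝ (u (T + (R * (lam j / 2)) ^ 2 * s / ν)) (x₀ + (R * (lam j / 2)) • y)) := by
      intro j
      have hfun : ((lam' j) • stPull ((lam' j) ^ 2) (lam' j) (0 : ℝ) (0 : (EuclideanSpace ℝ (Fin 3))) v') (-1) =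
          (((R * (lam' j / 2)) / ν) • stPull ((R * (lam' j / 2)) ^ 2 / ν) (R * (lam' j / 2)) T x₀ u)
            (-1) := by
        funext y'
        rw [hpt' j (-1) y', smul_stPull_apply]
        congr 2
        ring
      have e1 : R * (σ * lam j / 2) / ν * (R * (σ * lam j / 2)) = (-s) * ((R * (lam j / 2)) ^ 2 / ν) := by
        rw [← hσ2]; ring
      rw [hfun, fderiv_smul_stPull]
      simp only [hlam'def, smul_smul]
      rw [e1, show T + (R * (σ * lam j / 2)) ^ 2 / ν * (-1) = T + (R * (lam j / 2)) ^ 2 * s / ν by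
        rw [← e2 j]; ring, e3 j]
    have hlimit : fderiv ℝ (v₁' (-1)) (σ⁻¹ • y) = (-s) • fderiv ℝ (v₁ s) y := by
      simp only [hv₁'def]
      rw [fderiv_smul_stPull]
      simp only [smul_smul, mul_inv_cancel₀ hσne, one_smul, zero_add]
      rw [show σ ^ 2 * (-1) = s by rw [hσ2]; ring, show σ * σ = -s by rw [← hσ2]; ring]
    have key' : Tendsto (fun j => (-s) • (((R * (lam j / 2)) ^ 2 / ν) •
        fderiv ℝ (u (T + (R * (lam j / 2)) ^ 2 * s / ν)) (x₀ + (R * (lam j / 2)) • y))) atTop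
        (𝓝 ((-s) • fderiv ℝ (v₁ s) y)) := by
      rw [← hlimit]
      exact Tendsto.congr hgradZ key
    have key3 := key'.const_smul (-s)⁻¹
    simp only [smul_smul, inv_mul_cancel₀ hns.ne', inv_mul_cancel_left₀ hns.ne', one_smul]
      at key3
    exact key3

  · -- ## (iii) HESSIANS: (H) of `localZoomFrame_uniform` at time `−1` of the rescaled frame
    have key := (localZoomFrame_uniform hν hT hsol.smooth_velocity.continuousOn hρ hM hR hball1 hlam'
      hlam0' hr₁ hr₁1 hKs hpt' hL3' hae' hrate' hcont' hmild' (σ⁻¹ • y)).2.2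
    -- eventually the zoom times lie in `[0, T)`, where the slices of `u` are smooth
    have htj : Tendsto (fun j => T + (R * (lam j / 2)) ^ 2 * s / ν) atTop (𝓝[<] T) := by
      have h0 : Tendsto (fun j => (R * (lam j / 2)) ^ 2 * s / ν) atTop (𝓝 ((R * (0 / 2)) ^ 2 * s / ν)) :=
        ((((hlam0.div_const 2).const_mul R).pow 2).mul_const s).div_const ν
      rw [show (R * (0 / 2)) ^ 2 * s / ν = 0 by ring] at h0
      refine tendsto_nhdsWithin_iff.2 ⟨by simpa using h0.const_add T, Eventually.of_forall fun j => ?_⟩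
      have : (R * (lam j / 2)) ^ 2 * s / ν < 0 :=
        div_neg_of_neg_of_pos (mul_neg_of_pos_of_neg (pow_pos (mul_pos hR (half_pos (hlam j))) 2) hs) hν
      show T + (R * (lam j / 2)) ^ 2 * s / ν < T
      linarith
    have hev : ∀ᶠ j in atTop, T + (R * (lam j / 2)) ^ 2 * s / ν ∈ Ico 0 T :=
      (htj.eventually (Ioo_mem_nhdsLT hT)).mono fun j hj => Ioo_subset_Ico_self hj
    have hhessZ : ∀ᶠ j in atTop, iteratedFDeriv ℝ 2 (((lam' j) • stPull ((lam' j) ^ 2) (lam' j) (0 : ℝ)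
        (0 : (EuclideanSpace ℝ (Fin 3))) v') (-1)) (σ⁻¹ • y) = (σ ^ 3) • (((R * (lam j / 2)) ^ 3 / ν) •
          iteratedFDeriv ℝ 2 (u (T + (R * (lam j / 2)) ^ 2 * s / ν)) (x₀ + (R * (lam j / 2)) • y)) := by
      filter_upwards [hev] with j hj
      have hfun : ((lam' j) • stPull ((lam' j) ^ 2) (lam' j) (0 : ℝ) (0 : (EuclideanSpace ℝ (Fin 3))) v') (-1) =
          (((R * (lam' j / 2)) / ν) • stPull ((R * (lam' j / 2)) ^ 2 / ν) (R * (lam' j / 2)) T x₀ u)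
            (-1) := by
        funext y'
        rw [hpt' j (-1) y', smul_stPull_apply]
        congr 2
        ring
      have ht : T + (R * (lam' j / 2)) ^ 2 / ν * (-1) = T + (R * (lam j / 2)) ^ 2 * s / ν := by
        simp only [hlam'def]
        rw [← e2 j]
        ring
      have hu2 : ContDiff ℝ 2 (u (T + (R * (lam' j / 2)) ^ 2 / ν * (-1))) := by
        rw [ht]
        exact (hsol.contDiff_velocity hj).of_le (by norm_cast)
      rw [hfun, iteratedFDeriv_two_smul_stPull hu2, ht]
      simp only [hlam'def, smul_smul]
      have e1 : R * (σ * lam j / 2) / ν * (R * (σ * lam j / 2)) ^ 2 = σ ^ 3 * ((R * (lam j / 2)) ^ 3 / ν) := by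
        ring
      rw [e1, e3 j]
    have hlimit : iteratedFDeriv ℝ 2 (v₁' (-1)) (σ⁻¹ • y) = (σ ^ 3) • iteratedFDeriv ℝ 2 (v₁ s) y := by
      simp only [hv₁'def]
      have hs' : (0 : ℝ) + σ ^ 2 * (-1) = s := by rw [hσ2]; ring
      have hv2 : ContDiff ℝ 2 (v₁ ((0 : ℝ) + σ ^ 2 * (-1))) := by
        rw [hs']
        exact (analyticOnNhd_slice hP.2.1 (bdd_of_hasTypeITimeDecay hP.1) hP.2.2.1 hs).contDiff
      rw [iteratedFDeriv_two_smul_stPull hv2, hs']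
      simp only [smul_smul, mul_inv_cancel₀ hσne, one_smul, zero_add]
      congr 1
      ring
    have key' : Tendsto (fun j => (σ ^ 3) • (((R * (lam j / 2)) ^ 3 / ν) •
        iteratedFDeriv ℝ 2 (u (T + (R * (lam j / 2)) ^ 2 * s / ν)) (x₀ + (R * (lam j / 2)) • y))) atTop
        (𝓝 ((σ ^ 3) • iteratedFDeriv ℝ 2 (v₁ s) y)) := by
      rw [← hlimit]
      exact key.congr' hhessZ
    have hσ3 : σ ^ 3 ≠ 0 := pow_ne_zero 3 hσne
    have key3 := key'.const_smul (σ ^ 3)⁻¹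
    simp only [smul_smul, inv_mul_cancel_left₀ hσ3, inv_mul_cancel₀ hσ3, one_smul] at key3
    exact key3

end Summit.NavierStokesRegularity.NavierStokesRegularity.Theorems.LocalSineTubeDoorLocalPointZoomHessSlices

end
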